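import Summits.RiemannHypothesis.RiemannHypothesis.Theorems.IntegerScrewScrewPolyFloorLandauRatioSharp
import HarnessLib

/-!
# Route IntegerScrew — RH-free window lower bound for the Landau pairing, loss `O(M^{5/2})`

Helper file for crux `IntegerScrew.ScrewPolyFloor` (stmt-RiemannHypothesis-15757): the sharp form
of `pairing_window_lower_bound` (`IntegerScrewScrewPolyFloorLandauBlock.lean`). With
`D(T) = ∑_{|Im ρ| ≤ T} m(ρ) P_y(ρ − ½) P_y(½ − ρ)`, `P_y(s) = ∑_{m ≤ M} y_m m^s`, there is an absolute
`C` with, for `M ≥ 1`, `2 ≤ T₁ ≤ T₂`,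

  `Re(D(T₂) − D(T₁)) ≥ (N_±(T₂) − N_±(T₁)) ‖y‖² − ((T₂ − T₁)/π)(log M + 1) ‖y‖²
      − C M² √M (log²T₂ + log 3M) ‖y‖²`

(`pairing_window_lower_bound_sharp`; the crude form had `C M⁵ log²T₂`): the sharp resonance term of
`landau_gonek_formula_sharp` (`landauSum_ratio_bound_sharp`), Cauchy–Schwarz for the far pairs and
Schur's bound for the near-diagonal pairs (`IntegerScrewScrewPolyFloorLandauBilinear.lean`).
Downstream the RH-free tail floor then holds from height `M³` on (exponent `3` in place of `16`).
-/

noncomputable section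

open Complex Finset
open scoped Real ComplexConjugate

-- the layout-mandated namespace repeats the summit name
set_option linter.dupNamespace false

namespace Summit.RiemannHypothesis.RiemannHypothesis.Theorems.IntegerScrewLandau

open Literature.NumberTheory.LFunctions ArithmeticFunction

/-! ### The window lower bound, sharp form -/

set_option maxHeartbeats 1600000 in
/-- **RH-free lower bound for the Landau pairing over a window of zeros, sharp form.** There is an
absolute `C > 0` such that for all `M ≥ 1`, all real `y`, and all `2 ≤ T₁ ≤ T₂`,
`Re(D(T₂) − D(T₁)) ≥ (N_±(T₂) − N_±(T₁))·∑y² − ((T₂−T₁)/π)(log M + 1)·∑y² − C·M²√M·(log²T₂ + log 3M)·∑y²`,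
where `D(T) = ∑_{|Im ρ| ≤ T} m(ρ) P_y(ρ−½)P_y(−(ρ−½))`, `P_y(s) = ∑_{m ≤ M} y_m m^s`, and
`N_±(T) = ∑_{|Im ρ| ≤ T} m(ρ)`. As in `pairing_window_lower_bound` (symmetrisation, reflection, diagonal
`= N_± ∑y²`, Helson main terms via `combHelsonBound_proof`), with the entrywise error of
`landauSum_ratio_bound_sharp` summed by `sum_abs_mul_sum_abs_div_sq_le` and `bilinear_inv_sub_sq_le`.
[folklore] -/
theorem pairing_window_lower_bound_sharp :
    ∃ C : ℝ, 0 < C ∧ ∀ (M : ℕ), 1 ≤ M → ∀ (y : ℕ → ℝ) (T₁ T₂ : ℝ), 2 ≤ T₁ → T₁ ≤ T₂ →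
      ((∑ ρ ∈ (weilZeroIndex_finite T₂).toFinset, (riemannZetaZeroOrder ρ : ℝ)) -
          ∑ ρ ∈ (weilZeroIndex_finite T₁).toFinset, (riemannZetaZeroOrder ρ : ℝ)) *
            ∑ m ∈ Icc 1 M, y m ^ 2 -
        (T₂ - T₁) / π * (Real.log M + 1) * ∑ m ∈ Icc 1 M, y m ^ 2 -
        C * (M : ℝ) ^ 2 * Real.sqrt M * (Real.log T₂ ^ 2 + Real.log (3 * M)) * ∑ m ∈ Icc 1 M, y m ^ 2 ≤
      ((∑ ρ ∈ (weilZeroIndex_finite T₂).toFinset, (riemannZetaZeroOrder ρ : ℂ) *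
          ((∑ m ∈ Icc 1 M, (y m : ℂ) * (m : ℂ) ^ (ρ - 1 / 2)) *
            (∑ m ∈ Icc 1 M, (y m : ℂ) * (m : ℂ) ^ (-(ρ - 1 / 2))))) -
        ∑ ρ ∈ (weilZeroIndex_finite T₁).toFinset, (riemannZetaZeroOrder ρ : ℂ) *
          ((∑ m ∈ Icc 1 M, (y m : ℂ) * (m : ℂ) ^ (ρ - 1 / 2)) *
            (∑ m ∈ Icc 1 M, (y m : ℂ) * (m : ℂ) ^ (-(ρ - 1 / 2))))).re := by
  obtain ⟨CL, hCL0, hCL⟩ := LandauGonek.landau_gonek_formula_sharp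
  refine ⟨124 * CL, by positivity, fun M hM y T₁ T₂ hT₁ h12 ↦ ?_⟩
  classical
  have hT₂ : 2 ≤ T₂ := hT₁.trans h12
  have hM0 : (0 : ℝ) < M := by exact_mod_cast hM
  -- notation
  set I : Finset ℕ := Icc 1 M with hI
  set S : ℝ := ∑ m ∈ I, y m ^ 2 with hS
  set Lf : ℝ → ℕ → ℕ → ℂ := fun T m m' ↦ ∑ ρ ∈ (weilZeroIndex_finite T).toFinset,
    (riemannZetaZeroOrder ρ : ℂ) * ((((m : ℝ) / m' : ℝ)) : ℂ) ^ ρ with hLf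
  set Nc : ℝ → ℂ := fun T ↦ ∑ ρ ∈ (weilZeroIndex_finite T).toFinset, (riemannZetaZeroOrder ρ : ℂ)
    with hNc
  set Nr : ℝ → ℝ := fun T ↦ ∑ ρ ∈ (weilZeroIndex_finite T).toFinset, (riemannZetaZeroOrder ρ : ℝ)
    with hNr
  have hNre : ∀ T, (Nc T).re = Nr T := by
    intro T; simp only [hNc, hNr, Complex.re_sum, Complex.intCast_re]
  set c : ℕ → ℕ → ℝ := fun m m' ↦ Real.sqrt m' / Real.sqrt m with hc
  set Λr : ℕ → ℕ → ℝ := fun m m' ↦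
    (if ((⌊(m : ℝ) / m'⌋₊ : ℕ) : ℝ) = (m : ℝ) / m' then Λ ⌊(m : ℝ) / m'⌋₊ else 0) with hΛr
  set F : ℕ → ℕ → ℝ := fun m m' ↦ y m * y m' * c m m' * Λr m m' with hF
  set G : ℝ → ℕ → ℕ → ℂ := fun T m m' ↦ (y m : ℂ) * (y m' : ℂ) * ((c m m' : ℝ) : ℂ) * Lf T m m'
    with hG
  set ΔT : ℝ := T₂ - T₁ with hΔT
  have hΔT0 : 0 ≤ ΔT := by rw [hΔT]; linarith
  -- the entrywise error kernel
  set ℓ : ℝ := Real.log T₂ with hℓ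
  set lam : ℝ := Real.log (3 * M) with hlam
  have hM1r : (1 : ℝ) ≤ M := by exact_mod_cast hM
  have hlam0 : 0 ≤ lam := Real.log_nonneg (by linarith)
  have hℓ0 : 0 ≤ ℓ := Real.log_nonneg (by linarith)
  set Kf : ℕ → ℕ → ℝ := fun m m' ↦ if m' = m then 0 else 1 / ((m : ℝ) - m') ^ 2 with hKf
  have hKf0 : ∀ m m', 0 ≤ Kf m m' := fun m m' ↦ by simp only [hKf]; split_ifs <;> positivity
  have hKfsymm : ∀ m m', Kf m m' = Kf m' m := fun m m' ↦ by
    simp only [hKf]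
    by_cases h : m' = m
    · simp [h]
    · rw [if_neg h, if_neg (Ne.symm h), ← neg_sub, neg_sq]
  set Wf : ℕ → ℕ → ℝ := fun m m' ↦
    ((M : ℝ) ^ 2 / (m' : ℝ) ^ 2 + (M : ℝ) ^ 2 / (m : ℝ) ^ 2) * (10 * ℓ ^ 2 + lam) +
      8 * (M : ℝ) ^ 2 * Kf m m' * ℓ ^ 2 + M * lam with hWf
  have hWf0 : ∀ m m', 0 ≤ Wf m m' := fun m m' ↦ by have := hKf0 m m'; simp only [hWf]; positivity
  have hWfsymm : ∀ m m', Wf m m' = Wf m' m := fun m m' ↦ by simp only [hWf]; rw [hKfsymm m m']; ring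
  set Ef : ℕ → ℕ → ℝ := fun m m' ↦ 4 * CL * (|y m| * |y m'|) * Wf m m' with hEf
  have hEf0 : ∀ m m', 0 ≤ Ef m m' := fun m m' ↦ by have := hWf0 m m'; simp only [hEf]; positivity
  have hEfsymm : ∀ m m', Ef m m' = Ef m' m := fun m m' ↦ by simp only [hEf]; rw [hWfsymm m m']; ring
  -- the pairing as a double sum
  have hD : ∀ T, ∑ ρ ∈ (weilZeroIndex_finite T).toFinset, (riemannZetaZeroOrder ρ : ℂ) *
      ((∑ m ∈ Icc 1 M, (y m : ℂ) * (m : ℂ) ^ (ρ - 1 / 2)) *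
        (∑ m ∈ Icc 1 M, (y m : ℂ) * (m : ℂ) ^ (-(ρ - 1 / 2)))) = ∑ m ∈ I, ∑ m' ∈ I, G T m m' := by
    intro T; rw [pairingSum_eq]
  -- Landau at the ratios, both heights
  have hE : ∀ {m m' : ℕ}, 1 ≤ m' → m' < m → m ≤ M → ∀ {T : ℝ}, 2 ≤ T → T ≤ T₂ →
      ‖Lf T m m' + (((T / π * Λr m m' : ℝ)) : ℂ)‖ ≤ CL * Wf m m' := by
    intro m m' hm' hlt hmM T hT hTT₂
    refine (landauSum_ratio_bound_sharp hCL0 hCL hm' hlt hmM hT).trans ?_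
    refine mul_le_mul_of_nonneg_left ?_ hCL0.le
    have hlog : Real.log T ≤ ℓ := Real.log_le_log (by linarith) hTT₂
    have hlog0 : 0 ≤ Real.log T := Real.log_nonneg (by linarith)
    have hlogsq : Real.log T ^ 2 ≤ ℓ ^ 2 := pow_le_pow_left₀ hlog0 hlog 2
    have hm'0 : (0 : ℝ) < m' := by exact_mod_cast hm'
    have hmm' : (m' : ℝ) < m := by exact_mod_cast hlt
    have hm0 : (0 : ℝ) < m := by linarith
    have hmM' : (m : ℝ) ≤ M := by exact_mod_cast hmM
    have hne : m' ≠ m := hlt.ne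
    -- `x² ≤ M²/m'² ≤ M²/m'² + M²/m²`
    have hx2 : ((m : ℝ) / m') ^ 2 ≤ (M : ℝ) ^ 2 / (m' : ℝ) ^ 2 + (M : ℝ) ^ 2 / (m : ℝ) ^ 2 := by
      have h1 : ((m : ℝ) / m') ^ 2 ≤ (M : ℝ) ^ 2 / (m' : ℝ) ^ 2 := by
        rw [div_pow]; gcongr
      have h2 : 0 ≤ (M : ℝ) ^ 2 / (m : ℝ) ^ 2 := by positivity
      linarith
    -- `m²/(m−m')² ≤ M² K(m,m')`
    have hK : (m : ℝ) ^ 2 / ((m : ℝ) - m') ^ 2 ≤ (M : ℝ) ^ 2 * Kf m m' := by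
      simp only [hKf, if_neg hne]
      rw [mul_one_div]
      gcongr
    have hx20 : 0 ≤ ((m : ℝ) / m') ^ 2 := sq_nonneg _
    have hA0 : 0 ≤ (M : ℝ) ^ 2 / (m' : ℝ) ^ 2 + (M : ℝ) ^ 2 / (m : ℝ) ^ 2 := hx20.trans hx2
    have hKf0' := hKf0 m m'
    simp only [hWf]
    have p1 : 10 * ((m : ℝ) / m') ^ 2 * Real.log T ^ 2 ≤
        ((M : ℝ) ^ 2 / (m' : ℝ) ^ 2 + (M : ℝ) ^ 2 / (m : ℝ) ^ 2) * (10 * ℓ ^ 2) := by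
      calc 10 * ((m : ℝ) / m') ^ 2 * Real.log T ^ 2 ≤ 10 * ((M : ℝ) ^ 2 / (m' : ℝ) ^ 2 + (M : ℝ) ^ 2 / (m : ℝ) ^ 2) * ℓ ^ 2 := by
            gcongr
        _ = _ := by ring
    have p2 : 8 * ((m : ℝ) ^ 2 / ((m : ℝ) - m') ^ 2) * Real.log T ^ 2 ≤ 8 * (M : ℝ) ^ 2 * Kf m m' * ℓ ^ 2 := by
      calc 8 * ((m : ℝ) ^ 2 / ((m : ℝ) - m') ^ 2) * Real.log T ^ 2 ≤ 8 * ((M : ℝ) ^ 2 * Kf m m') * ℓ ^ 2 := by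
            gcongr
        _ = _ := by ring
    have p3 : ((m : ℝ) / m') ^ 2 * lam ≤ ((M : ℝ) ^ 2 / (m' : ℝ) ^ 2 + (M : ℝ) ^ 2 / (m : ℝ) ^ 2) * lam :=
      mul_le_mul_of_nonneg_right hx2 hlam0
    nlinarith [p1, p2, p3]
  -- the diagonal and the vanishing main terms
  have hcmm : ∀ {m : ℕ}, 1 ≤ m → c m m = 1 := fun {m} hm ↦ by
    simp only [hc]; exact div_self (Real.sqrt_pos.2 (by exact_mod_cast hm)).ne'
  have hΛmm : ∀ {m : ℕ}, 1 ≤ m → Λr m m = 0 := fun {m} hm ↦ by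
    simp only [hΛr]
    rw [div_self (by exact_mod_cast (Nat.one_le_iff_ne_zero.1 hm) : (m : ℝ) ≠ 0),
      show (1 : ℝ) = ((1 : ℕ) : ℝ) by norm_num, vonMangoldtReal_natCast]
    simp
  have hΛlt : ∀ {m m' : ℕ}, 1 ≤ m' → m' < m → Λr m' m = 0 := fun {m m'} hm' hlt ↦ by
    simp only [hΛr]
    have hm0 : (0 : ℝ) < m := by exact_mod_cast (lt_of_lt_of_le (Nat.lt_of_succ_le hm') hlt.le)
    exact vonMangoldtReal_eq_zero_of_lt_one (by positivity) ((div_lt_one hm0).2 (by exact_mod_cast hlt))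
  have hLf_mm : ∀ {m : ℕ}, 1 ≤ m → ∀ T, Lf T m m = Nc T := fun {m} hm T ↦ by
    simp only [hLf, hNc]
    rw [div_self (by exact_mod_cast (Nat.one_le_iff_ne_zero.1 hm) : (m : ℝ) ≠ 0)]
    exact landauSum_one T
  -- reflection: `G T m' m = G T m m'` for `m' < m`
  have hGsymm : ∀ {m m' : ℕ}, 1 ≤ m' → m' < m → ∀ T, G T m' m = G T m m' := by
    intro m m' hm' hlt T
    have hm0 : (0 : ℝ) < m := by exact_mod_cast (lt_of_lt_of_le (Nat.lt_of_succ_le hm') hlt.le)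
    have hm'0 : (0 : ℝ) < m' := by exact_mod_cast hm'
    have hx : (0 : ℝ) < (m' : ℝ) / m := by positivity
    simp only [hG, hLf, hc]
    rw [landauSum_reflect hx T, inv_div]
    have hsq : Real.sqrt m * Real.sqrt m = m := Real.mul_self_sqrt hm0.le
    have hsq' : Real.sqrt m' * Real.sqrt m' = m' := Real.mul_self_sqrt hm'0.le
    have hs0 : Real.sqrt m ≠ 0 := (Real.sqrt_pos.2 hm0).ne'
    have hs0' : Real.sqrt m' ≠ 0 := (Real.sqrt_pos.2 hm'0).ne'
    have key : ((Real.sqrt m / Real.sqrt m' : ℝ) : ℂ) * ((((m' : ℝ) / m : ℝ)) : ℂ) =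
        ((Real.sqrt m' / Real.sqrt m : ℝ) : ℂ) := by
      norm_cast
      field_simp
      nlinarith [hsq, hsq']
    calc (y m' : ℂ) * (y m : ℂ) * ((Real.sqrt m / Real.sqrt m' : ℝ) : ℂ) *
          (((((m' : ℝ) / m : ℝ)) : ℂ) * ∑ ρ ∈ (weilZeroIndex_finite T).toFinset,
            (riemannZetaZeroOrder ρ : ℂ) * ((((m : ℝ) / m' : ℝ)) : ℂ) ^ ρ)
        = (y m : ℂ) * (y m' : ℂ) * (((Real.sqrt m / Real.sqrt m' : ℝ) : ℂ) * ((((m' : ℝ) / m : ℝ)) : ℂ)) *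
            ∑ ρ ∈ (weilZeroIndex_finite T).toFinset,
              (riemannZetaZeroOrder ρ : ℂ) * ((((m : ℝ) / m' : ℝ)) : ℂ) ^ ρ := by ring
      _ = _ := by rw [key]
  -- termwise bound, ordered pairs `m' < m`
  have hpair : ∀ {m m' : ℕ}, 1 ≤ m' → m' < m → m ≤ M →
      -(ΔT / π * (2 * (F m m' + F m' m))) - Ef m m' ≤
        ((G T₂ m m' - G T₁ m m') + (G T₂ m' m - G T₁ m' m)).re := by
    intro m m' hm' hlt hmM
    have hm0 : (0 : ℝ) < m := by exact_mod_cast (lt_of_lt_of_le (Nat.lt_of_succ_le hm') hlt.le)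
    have hm'0 : (0 : ℝ) < m' := by exact_mod_cast hm'
    rw [hGsymm hm' hlt T₂, hGsymm hm' hlt T₁]
    -- `F m' m = 0`, `c m m' ≤ 1`
    have hF' : F m' m = 0 := by simp only [hF]; rw [hΛlt hm' hlt, mul_zero]
    have hc1 : c m m' ≤ 1 := by
      simp only [hc]
      rw [div_le_one (Real.sqrt_pos.2 hm0)]
      exact Real.sqrt_le_sqrt (by exact_mod_cast hlt.le)
    have hc0 : 0 ≤ c m m' := by simp only [hc]; positivity
    -- Landau at both heights
    set e₂ : ℂ := Lf T₂ m m' + (((T₂ / π * Λr m m' : ℝ)) : ℂ) with he₂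
    set e₁ : ℂ := Lf T₁ m m' + (((T₁ / π * Λr m m' : ℝ)) : ℂ) with he₁
    have hne₂ := hE hm' hlt hmM hT₂ le_rfl
    have hne₁ := hE hm' hlt hmM hT₁ h12
    rw [← he₂] at hne₂
    rw [← he₁] at hne₁
    have hdiff : (G T₂ m m' - G T₁ m m') + (G T₂ m m' - G T₁ m m') =
        2 * ((y m : ℂ) * (y m' : ℂ) * ((c m m' : ℝ) : ℂ)) *
          (-(((ΔT / π * Λr m m' : ℝ)) : ℂ) + (e₂ - e₁)) := by
      simp only [hG, he₂, he₁, hΔT]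
      push_cast
      ring
    rw [hdiff, hF', add_zero]
    -- real part
    have hre : (2 * ((y m : ℂ) * (y m' : ℂ) * ((c m m' : ℝ) : ℂ)) *
        (-(((ΔT / π * Λr m m' : ℝ)) : ℂ) + (e₂ - e₁))).re =
        -(ΔT / π * (2 * F m m')) + 2 * (y m * y m' * c m m') * (e₂ - e₁).re := by
      have e : (2 * ((y m : ℂ) * (y m' : ℂ) * ((c m m' : ℝ) : ℂ))) = (((2 * (y m * y m' * c m m') : ℝ)) : ℂ) := by
        push_cast; ring
      rw [e, Complex.re_ofReal_mul, Complex.add_re, Complex.neg_re, Complex.ofReal_re]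
      simp only [hF]
      ring
    rw [hre]
    have hB0 : 0 ≤ 2 * CL * Wf m m' := by have := hWf0 m m'; positivity
    have hEE : |(e₂ - e₁).re| ≤ 2 * CL * Wf m m' := by
      calc |(e₂ - e₁).re| ≤ ‖e₂ - e₁‖ := Complex.abs_re_le_norm _
        _ ≤ ‖e₂‖ + ‖e₁‖ := norm_sub_le _ _
        _ ≤ CL * Wf m m' + CL * Wf m m' := add_le_add hne₂ hne₁
        _ = 2 * CL * Wf m m' := by ring
    have hprod : |2 * (y m * y m' * c m m') * (e₂ - e₁).re| ≤ Ef m m' := by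
      rw [abs_mul, abs_mul, abs_mul, abs_mul, abs_of_pos (by norm_num : (0 : ℝ) < 2), abs_of_nonneg hc0]
      calc 2 * (|y m| * |y m'| * c m m') * |(e₂ - e₁).re| ≤ 2 * (|y m| * |y m'| * 1) * (2 * CL * Wf m m') := by
            gcongr
        _ = Ef m m' := by simp only [hEf]; ring
    have := neg_abs_le (2 * (y m * y m' * c m m') * (e₂ - e₁).re)
    linarith
  -- termwise bound, all pairs
  have hterm : ∀ m ∈ I, ∀ m' ∈ I,
      (if m = m' then 2 * y m ^ 2 * (Nr T₂ - Nr T₁) else 0) -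
          ΔT / π * (2 * (F m m' + F m' m)) - Ef m m' ≤
        ((G T₂ m m' - G T₁ m m') + (G T₂ m' m - G T₁ m' m)).re := by
    intro m hm m' hm'
    rw [hI, Finset.mem_Icc] at hm hm'
    rcases lt_trichotomy m' m with hlt | heq | hgt
    · rw [if_neg (by omega : m ≠ m')]
      have := hpair hm'.1 hlt hm.2
      linarith
    · subst heq
      rw [if_pos rfl]
      have hFmm : F m' m' = 0 := by simp only [hF]; rw [hΛmm hm.1, mul_zero]
      have hGmm : ∀ T, G T m' m' = (((y m' ^ 2 : ℝ)) : ℂ) * Nc T := fun T ↦ by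
        simp only [hG]; rw [hLf_mm hm.1, hcmm hm.1]; push_cast; ring
      rw [hFmm, hGmm, hGmm]
      have hre : ((((y m' ^ 2 : ℝ)) : ℂ) * Nc T₂ - (((y m' ^ 2 : ℝ)) : ℂ) * Nc T₁ +
          ((((y m' ^ 2 : ℝ)) : ℂ) * Nc T₂ - (((y m' ^ 2 : ℝ)) : ℂ) * Nc T₁)).re =
          2 * y m' ^ 2 * (Nr T₂ - Nr T₁) := by
        simp only [Complex.add_re, Complex.sub_re, Complex.re_ofReal_mul, hNre]
        ring
      rw [hre]
      have : 0 ≤ Ef m' m' := hEf0 m' m'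
      linarith
    · rw [if_neg (by omega : m ≠ m')]
      have := hpair hm.1 hgt hm'.2
      rw [add_comm (F m' m), add_comm (G T₂ m' m - G T₁ m' m), hEfsymm m' m] at this
      linarith
  -- summation of the termwise bounds
  have hsum := Finset.sum_le_sum fun m hm ↦ Finset.sum_le_sum fun m' hm' ↦ hterm m hm m' hm'
  -- the left side, summed
  have hdiag : ∑ m ∈ I, ∑ m' ∈ I, (if m = m' then 2 * y m ^ 2 * (Nr T₂ - Nr T₁) else 0) =
      2 * (Nr T₂ - Nr T₁) * S := by
    rw [hS, Finset.mul_sum]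
    refine Finset.sum_congr rfl fun m hm ↦ ?_
    rw [Finset.sum_ite_eq I m (fun _ ↦ 2 * y m ^ 2 * (Nr T₂ - Nr T₁)), if_pos hm]
    ring
  have hFsum : ∑ m ∈ I, ∑ m' ∈ I, ΔT / π * (2 * (F m m' + F m' m)) =
      ΔT / π * (4 * ∑ m ∈ I, ∑ m' ∈ I, F m m') := by
    have h1 : ∑ m ∈ I, ∑ m' ∈ I, (F m m' + F m' m) = 2 * ∑ m ∈ I, ∑ m' ∈ I, F m m' := by
      simp only [Finset.sum_add_distrib]
      rw [Finset.sum_comm (f := fun m m' ↦ F m' m)]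
      ring
    simp only [← Finset.mul_sum]
    rw [h1]
    ring
  -- the bilinear error sum
  have hEsum : ∑ m ∈ I, ∑ m' ∈ I, Ef m m' ≤ 248 * CL * (M : ℝ) ^ 2 * Real.sqrt M * (ℓ ^ 2 + lam) * S := by
    set A : ℝ := ∑ m ∈ I, |y m| with hA
    set Bq : ℝ := ∑ m ∈ I, |y m| / (m : ℝ) ^ 2 with hBq
    have hA0 : 0 ≤ A := Finset.sum_nonneg fun _ _ ↦ abs_nonneg _
    have hS0 : 0 ≤ S := Finset.sum_nonneg fun _ _ ↦ sq_nonneg _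
    have hAB : A * Bq ≤ Real.sqrt (2 * M) * S := by rw [hA, hBq, hS, hI]; exact sum_abs_mul_sum_abs_div_sq_le M y
    have hKsum : ∑ m ∈ I, ∑ m' ∈ I, |y m| * |y m'| * Kf m m' ≤ 4 * S := by
      rw [hS, hI]; exact bilinear_inv_sub_sq_le M y
    have hAA : A ^ 2 ≤ M * S := by rw [hA, hS, hI]; exact sq_sum_abs_le M y
    -- decomposition of `Ef`
    have hdec : ∀ m m', Ef m m' =
        (4 * CL * (M : ℝ) ^ 2 * (10 * ℓ ^ 2 + lam)) * (|y m| * (|y m'| / (m' : ℝ) ^ 2)) +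
        (4 * CL * (M : ℝ) ^ 2 * (10 * ℓ ^ 2 + lam)) * ((|y m| / (m : ℝ) ^ 2) * |y m'|) +
        (32 * CL * (M : ℝ) ^ 2 * ℓ ^ 2) * (|y m| * |y m'| * Kf m m') +
        (4 * CL * M * lam) * (|y m| * |y m'|) := by
      intro m m'
      simp only [hEf, hWf]
      ring
    have hs1 : ∑ m ∈ I, ∑ m' ∈ I, |y m| * (|y m'| / (m' : ℝ) ^ 2) = A * Bq := by
      rw [hA, hBq, Finset.sum_mul_sum]
    have hs2 : ∑ m ∈ I, ∑ m' ∈ I, (|y m| / (m : ℝ) ^ 2) * |y m'| = Bq * A := by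
      rw [hA, hBq, Finset.sum_mul_sum]
    have hs4 : ∑ m ∈ I, ∑ m' ∈ I, |y m| * |y m'| = A ^ 2 := by
      rw [hA, sq, Finset.sum_mul_sum]
    have hsum_eq : ∑ m ∈ I, ∑ m' ∈ I, Ef m m' =
        (4 * CL * (M : ℝ) ^ 2 * (10 * ℓ ^ 2 + lam)) * (A * Bq) +
        (4 * CL * (M : ℝ) ^ 2 * (10 * ℓ ^ 2 + lam)) * (Bq * A) +
        (32 * CL * (M : ℝ) ^ 2 * ℓ ^ 2) * (∑ m ∈ I, ∑ m' ∈ I, |y m| * |y m'| * Kf m m') +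
        (4 * CL * M * lam) * A ^ 2 := by
      rw [← hs1, ← hs2, ← hs4]
      simp only [Finset.mul_sum]
      rw [← Finset.sum_add_distrib, ← Finset.sum_add_distrib, ← Finset.sum_add_distrib]
      refine Finset.sum_congr rfl fun m _ ↦ ?_
      rw [← Finset.sum_add_distrib, ← Finset.sum_add_distrib, ← Finset.sum_add_distrib]
      refine Finset.sum_congr rfl fun m' _ ↦ ?_
      exact hdec m m'
    rw [hsum_eq]
    -- sizes
    have hsqrt2 : Real.sqrt 2 ≤ 3 / 2 := by
      rw [show (3 / 2 : ℝ) = Real.sqrt ((3 / 2) ^ 2) by rw [Real.sqrt_sq (by norm_num)]]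
      exact Real.sqrt_le_sqrt (by norm_num)
    have hsqM1 : 1 ≤ Real.sqrt M := by
      rw [show (1 : ℝ) = Real.sqrt 1 by simp]; exact Real.sqrt_le_sqrt hM1r
    have hsqM0 : 0 ≤ Real.sqrt M := Real.sqrt_nonneg _
    have hAB' : A * Bq ≤ 3 / 2 * Real.sqrt M * S := by
      calc A * Bq ≤ Real.sqrt (2 * M) * S := hAB
        _ = Real.sqrt 2 * Real.sqrt M * S := by rw [Real.sqrt_mul (by norm_num)]
        _ ≤ 3 / 2 * Real.sqrt M * S := by gcongr
    have hBA' : Bq * A ≤ 3 / 2 * Real.sqrt M * S := by rw [mul_comm]; exact hAB'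
    have hMS : (M : ℝ) * S ≤ (M : ℝ) * Real.sqrt M * S := by
      have : (M : ℝ) * S * 1 ≤ (M : ℝ) * S * Real.sqrt M :=
        mul_le_mul_of_nonneg_left hsqM1 (by positivity)
      linarith
    have hS4 : 4 * S ≤ 4 * Real.sqrt M * S := by
      have : 4 * S * 1 ≤ 4 * S * Real.sqrt M := mul_le_mul_of_nonneg_left hsqM1 (by positivity)
      linarith
    calc (4 * CL * (M : ℝ) ^ 2 * (10 * ℓ ^ 2 + lam)) * (A * Bq) +
          (4 * CL * (M : ℝ) ^ 2 * (10 * ℓ ^ 2 + lam)) * (Bq * A) +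
          (32 * CL * (M : ℝ) ^ 2 * ℓ ^ 2) * (∑ m ∈ I, ∑ m' ∈ I, |y m| * |y m'| * Kf m m') +
          (4 * CL * M * lam) * A ^ 2
        ≤ (4 * CL * (M : ℝ) ^ 2 * (10 * ℓ ^ 2 + lam)) * (3 / 2 * Real.sqrt M * S) +
          (4 * CL * (M : ℝ) ^ 2 * (10 * ℓ ^ 2 + lam)) * (3 / 2 * Real.sqrt M * S) +
          (32 * CL * (M : ℝ) ^ 2 * ℓ ^ 2) * (4 * Real.sqrt M * S) +
          (4 * CL * M * lam) * ((M : ℝ) * Real.sqrt M * S) := by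
          gcongr
          · exact hKsum.trans hS4
          · exact hAA.trans hMS
      _ = CL * (M : ℝ) ^ 2 * Real.sqrt M * (248 * ℓ ^ 2 + 16 * lam) * S := by ring
      _ ≤ 248 * CL * (M : ℝ) ^ 2 * Real.sqrt M * (ℓ ^ 2 + lam) * S := by
          have h0 : 0 ≤ CL * (M : ℝ) ^ 2 * Real.sqrt M * S * lam := by positivity
          nlinarith [h0]
  have hLHS : ∑ m ∈ I, ∑ m' ∈ I,
      ((if m = m' then 2 * y m ^ 2 * (Nr T₂ - Nr T₁) else 0) -
        ΔT / π * (2 * (F m m' + F m' m)) - Ef m m') =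
      2 * (Nr T₂ - Nr T₁) * S - ΔT / π * (4 * ∑ m ∈ I, ∑ m' ∈ I, F m m') -
        ∑ m ∈ I, ∑ m' ∈ I, Ef m m' := by
    simp only [Finset.sum_sub_distrib]
    rw [hdiag, hFsum]
  -- the right side, summed: twice the real part of the difference
  have hRHS : ∑ m ∈ I, ∑ m' ∈ I, ((G T₂ m m' - G T₁ m m') + (G T₂ m' m - G T₁ m' m)).re =
      2 * ((∑ m ∈ I, ∑ m' ∈ I, G T₂ m m') - ∑ m ∈ I, ∑ m' ∈ I, G T₁ m m').re := by
    have h := sum_sum_eq_half_symm I (fun m m' ↦ G T₂ m m' - G T₁ m m')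
    have h2 : (∑ m ∈ I, ∑ m' ∈ I, G T₂ m m') - ∑ m ∈ I, ∑ m' ∈ I, G T₁ m m' =
        ∑ m ∈ I, ∑ m' ∈ I, (G T₂ m m' - G T₁ m m') := by
      simp only [Finset.sum_sub_distrib]
    rw [h2, h]
    simp only [Complex.re_sum, Complex.mul_re, Complex.re_sum]
    norm_num
    ring
  -- Helson and Cauchy–Schwarz
  have hHelson : 2 * ∑ m ∈ I, ∑ m' ∈ I, F m m' ≤ (Real.log M + 1) * S := by
    have h := two_mul_mainTerms_le hM y
    simp only [hF, hc, hΛr, hI, hS] at h ⊢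
    exact h
  -- conclusion
  rw [hD T₂, hD T₁]
  have key : 2 * ((Nr T₂ - Nr T₁) * S - ΔT / π * (Real.log M + 1) * S -
      124 * CL * (M : ℝ) ^ 2 * Real.sqrt M * (ℓ ^ 2 + lam) * S) ≤
      2 * ((∑ m ∈ I, ∑ m' ∈ I, G T₂ m m') - ∑ m ∈ I, ∑ m' ∈ I, G T₁ m m').re := by
    rw [← hRHS]
    refine le_trans ?_ (hLHS ▸ hsum)
    have hπ : 0 ≤ ΔT / π := div_nonneg hΔT0 Real.pi_pos.le
    have h1 : ΔT / π * (4 * ∑ m ∈ I, ∑ m' ∈ I, F m m') ≤ ΔT / π * (2 * ((Real.log M + 1) * S)) := by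
      refine mul_le_mul_of_nonneg_left ?_ hπ
      linarith
    linarith [hEsum]
  rw [hΔT, hℓ, hlam] at key
  linarith

end Summit.RiemannHypothesis.RiemannHypothesis.Theorems.IntegerScrewLandau

end
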